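import Summits.CriticalPhenomena.PercolationContinuityZ3.Theorems.PercNonProliferationNonProliferationOfOneRatioThreeCrossers
import HarnessLib

/-!
# Crux `PercNonProliferation.NonProliferation` (stmt-CriticalPhenomena-4444), line `avoidance-cost-covering`:
# the one-ratio criterion at ANY multiplicity implies the crux

Lead file (prover-line-stmt-CriticalPhenomena-4444-a1). The landed socket
`nonProliferation_of_oneRatioThreeCrossers` (p129664) reduces the crux to the line's open stub: ONE ratio
`k₀`, THREE shell-distinct crossers, threshold `(k₀+1)^{-2}`, uniformly in the scale. Nothing in the bootstrap
is specific to the multiplicity three: the restriction of shell crossers to sub-shells (`stub_subshellCrossers`),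
the independence of disjoint shells (`stub_disjointShellsIndep`), the box-to-shell surgery
(`stub_shellOfBoxCrossers`) and the mid-sphere covering socket (`nonProliferation_of_frequently_multiCross`) are
all stated for `r + 1` crossers. This file records the resulting TWO-PARAMETER family of sufficient inputs

  `C(r, k₀)`: `∃ a₀ q, (k₀+1)² q < 1 ∧ ∀ a ≥ a₀, P_{p_c}(r+1 shell-distinct crossers of Sh(a, k₀ a)) ≤ q`,

any member of which closes the crux (`nonProliferation_of_oneRatioMultiCrossers`; the open stub is `C(2, k₀)`).
Why it is worth having: the members trade ratio for multiplicity at the SAME order-one threshold, and the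
small-ratio/high-multiplicity members (e.g. `k₀ = 4`, `r + 1 = 8`: threshold `1/25` against a measured
`P ≈ 10⁻³`) can be tested for uniformity in the scale `a` over more than a decade of scales, which the
three-crosser member (criterion first met near `k₀ ≈ 40`) cannot. The costume caveat of triage (α) concerns
`k₀ = 2` only, where `C(r, 2)` contains the crux outright (box count ≤ shell count at the same ratio); for
`k₀ ≥ 3` the crux's ratio-2 annulus count is not dominated by any `C(r, k₀)` without the ladder and the covering.

Proof: verbatim the three-crosser composition with `2 ↦ r` — shell submultiplicativity
(`real_shellMulti_submult`), the abstract ladder `OneRatioThreeCrossers.ladder_of_submult`, the choice of the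
number of shells `OneRatioThreeCrossers.exists_mul_pow_le_half`, box ⊆ shell a.s., and the covering socket with
`M = r · 726 k²`, `c = 1/2`.
-/

noncomputable section

namespace Summit.CriticalPhenomena.PercolationContinuityZ3.Theorems.NonProliferation

open MeasureTheory Filter Topology
open Literature.Probability.LatticeModels Literature.Probability.Percolation
open OneRatioThreeCrossers

/-- The closed shell `Sh(a, c) = {v ∈ B(c) | ∃ l, a ≤ |v l|}` of `ℤ³` (local notation only). -/
local notation3 "Sh⟦" a ", " c "⟧" =>
  ({v : Site 3 | v ∈ box 3 c ∧ ∃ l : Fin 3, ((a : ℕ) : ℤ) ≤ |v l|} : Set (Site 3))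

/-- The shell multi-crosser event `E_r(a, c)` of `ℤ³`: `r + 1` shell-distinct crossers (local notation only). -/
local notation3 "E⟦" r "; " a ", " c "⟧" =>
  ({ω : BondConfig (Site 3) | ∃ x : Fin (r + 1) → Site 3, (∀ i, x i ∈ box 3 a) ∧
    (∀ i, ∃ y ∈ innerBoundary (zdGraph 3) (box 3 c), ω ∈ openConnIn Sh⟦a, c⟧ (x i) y) ∧
    ∀ i j, i ≠ j → ω ∉ openConnIn Sh⟦a, c⟧ (x i) (x j)} : Set (BondConfig (Site 3)))

namespace OneRatioMultiCrossers

/-- **Shell submultiplicativity at multiplicity `r + 1`** (every `p`): for `a ≤ b < b' ≤ c`,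
`P_p(E_r(a,c)) ≤ P_p(E_r(a,b)) · P_p(E_r(b',c))` (`ae_subset_edgeSet`, `stub_subshellCrossers`,
`stub_disjointShellsIndep`). -/
theorem real_shellMulti_submult (r : ℕ) (p : unitInterval) {a b b' c : ℕ} (hab : a ≤ b) (hbb' : b < b')
    (hb'c : b' ≤ c) :
    (bondPercolation (zdGraph 3) p).real E⟦r; a, c⟧ ≤
      (bondPercolation (zdGraph 3) p).real E⟦r; a, b⟧ * (bondPercolation (zdGraph 3) p).real E⟦r; b', c⟧ := by
  have hincl : ∀ᵐ ω ∂(bondPercolation (zdGraph 3) p), ω ∈ E⟦r; a, c⟧ → ω ∈ E⟦r; a, b⟧ ∩ E⟦r; b', c⟧ := by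
    filter_upwards [ae_subset_edgeSet (zdGraph 3) p] with ω hω hmem
    exact stub_subshellCrossers 3 r a b b' c ω hab (by omega) (by omega) hb'c hω hmem
  calc (bondPercolation (zdGraph 3) p).real E⟦r; a, c⟧
      ≤ (bondPercolation (zdGraph 3) p).real (E⟦r; a, b⟧ ∩ E⟦r; b', c⟧) := by
        simp only [measureReal_def]
        exact ENNReal.toReal_mono (measure_ne_top _ _) (measure_mono_ae hincl)
    _ ≤ _ := stub_disjointShellsIndep 3 r a b b' c p hbb'

/-- **The ladder at multiplicity `r + 1`**: `P_{p_c}(E_r(a, k₀ a)) ≤ q ∀ a ≥ a₀` gives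
`P_{p_c}(E_r(a, k₀ (k₀+1)^j a)) ≤ q^{j+1}` for all `j`, `a ≥ a₀` (`ladder_of_submult`). -/
theorem real_shellMulti_ladder (r : ℕ) {k₀ a₀ : ℕ} {q : ℝ} (hk₀ : 1 ≤ k₀) (ha₀ : 1 ≤ a₀)
    (hcrit : ∀ a : ℕ, a₀ ≤ a →
      (bondPercolation (zdGraph 3) (criticalProbI 3)).real E⟦r; a, k₀ * a⟧ ≤ q) :
    ∀ j a : ℕ, a₀ ≤ a →
      (bondPercolation (zdGraph 3) (criticalProbI 3)).real E⟦r; a, k₀ * (k₀ + 1) ^ j * a⟧ ≤ q ^ (j + 1) :=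
  ladder_of_submult (P := fun a c => (bondPercolation (zdGraph 3) (criticalProbI 3)).real E⟦r; a, c⟧)
    (fun _ _ => measureReal_nonneg)
    (fun _ _ _ _ hab hbb' hb'c => real_shellMulti_submult r (criticalProbI 3) hab hbb' hb'c)
    hk₀ ha₀ hcrit

end OneRatioMultiCrossers

open OneRatioMultiCrossers in
/-- **Any member `C(r, k₀)` of the one-ratio family implies the crux.** If for some multiplicity `r + 1`,
ratio `k₀ ≥ 2`, scale `a₀ ≥ 1` and `q` with `(k₀+1)² q < 1` the critical probability of `r + 1`
shell-distinct crossers of `Sh(a, k₀ a)` is `≤ q` for every `a ≥ a₀`, then `NonProliferation` holds: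
ladder to the ratio `k = k₀ (k₀+1)^j` with `726 k₀² q ((k₀+1)² q)^j ≤ 1/2`, box crossers ⊆ shell crossers
a.s. (`stub_shellOfBoxCrossers`), and the covering socket `nonProliferation_of_frequently_multiCross`
(multiplicity `r`, `M = r · 726 k²`, `c = 1/2`). The registered open stub `stub_oneRatioThreeCrossers` is the
member `r = 2`. -/
theorem nonProliferation_of_oneRatioMultiCrossers :
    (∃ r k₀ a₀ : ℕ, ∃ q : ℝ, 2 ≤ k₀ ∧ 1 ≤ a₀ ∧ ((k₀ : ℝ) + 1) ^ 2 * q < 1 ∧ ∀ a : ℕ, a₀ ≤ a →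
      (bondPercolation (zdGraph 3) (criticalProbI 3)).real
        {ω | ∃ x : Fin (r + 1) → Site 3, (∀ i, x i ∈ box 3 a) ∧
          (∀ i, ∃ y ∈ innerBoundary (zdGraph 3) (box 3 (k₀ * a)),
            ω ∈ openConnIn {v : Site 3 | v ∈ box 3 (k₀ * a) ∧ ∃ l : Fin 3, (a : ℤ) ≤ |v l|} (x i) y) ∧
          ∀ i j, i ≠ j →
            ω ∉ openConnIn {v : Site 3 | v ∈ box 3 (k₀ * a) ∧ ∃ l : Fin 3, (a : ℤ) ≤ |v l|} (x i) (x j)}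
        ≤ q) →
    Summit.CriticalPhenomena.PercolationContinuityZ3.Theses.PercNonProliferation.NonProliferation := by
  rintro ⟨r, k₀, a₀, q, hk₀, ha₀, hθ, hcrit⟩
  set μ : Measure (BondConfig (Site 3)) := bondPercolation (zdGraph 3) (criticalProbI 3) with hμ
  have hq0 : 0 ≤ q := le_trans measureReal_nonneg (hcrit a₀ le_rfl)
  have hlad := real_shellMulti_ladder r (q := q) (show 1 ≤ k₀ by omega) ha₀ hcrit
  set t : ℝ := ((k₀ : ℝ) + 1) ^ 2 * q with ht
  have ht0 : 0 ≤ t := by positivity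
  set A : ℝ := 726 * (k₀ : ℝ) ^ 2 * q with hA
  have hA0 : 0 ≤ A := by positivity
  obtain ⟨j, hjA⟩ := exists_mul_pow_le_half hA0 ht0 hθ
  have hK : 1 ≤ (k₀ + 1) ^ j := Nat.one_le_pow _ _ (by omega)
  have hk2 : 2 ≤ k₀ * (k₀ + 1) ^ j :=
    calc 2 ≤ k₀ := hk₀
      _ = k₀ * 1 := (mul_one _).symm
      _ ≤ k₀ * (k₀ + 1) ^ j := Nat.mul_le_mul_left _ hK
  refine nonProliferation_of_frequently_multiCross ⟨k₀ * (k₀ + 1) ^ j, r, hk2, Eventually.frequently ?_⟩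
  filter_upwards [eventually_ge_atTop a₀] with m hm
  have hmL : m ≤ k₀ * (k₀ + 1) ^ j * m := Nat.le_mul_of_pos_left m (Nat.mul_pos (by omega) (by positivity))
  have hincl : ∀ᵐ ω ∂μ,
      ω ∈ {ω | ∃ x : Fin (r + 1) → Site 3, (∀ i, x i ∈ box 3 m) ∧
        (∀ i, ∃ y ∈ innerBoundary (zdGraph 3) (box 3 (k₀ * (k₀ + 1) ^ j * m)),
          ω ∈ openConnIn (↑(box 3 (k₀ * (k₀ + 1) ^ j * m)) : Set (Site 3)) (x i) y) ∧
        ∀ i j', i ≠ j' → ω ∉ openConnIn (↑(box 3 (k₀ * (k₀ + 1) ^ j * m)) : Set (Site 3)) (x i) (x j')} →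
      ω ∈ E⟦r; m, k₀ * (k₀ + 1) ^ j * m⟧ := by
    filter_upwards [ae_subset_edgeSet (zdGraph 3) (criticalProbI 3)] with ω hω hmem
    exact stub_shellOfBoxCrossers 3 r m _ ω hmL hω hmem
  have hbox : μ.real {ω | ∃ x : Fin (r + 1) → Site 3, (∀ i, x i ∈ box 3 m) ∧
        (∀ i, ∃ y ∈ innerBoundary (zdGraph 3) (box 3 (k₀ * (k₀ + 1) ^ j * m)),
          ω ∈ openConnIn (↑(box 3 (k₀ * (k₀ + 1) ^ j * m)) : Set (Site 3)) (x i) y) ∧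
        ∀ i j', i ≠ j' → ω ∉ openConnIn (↑(box 3 (k₀ * (k₀ + 1) ^ j * m)) : Set (Site 3)) (x i) (x j')}
      ≤ q ^ (j + 1) := by
    calc _ ≤ μ.real E⟦r; m, k₀ * (k₀ + 1) ^ j * m⟧ := by
          simp only [measureReal_def]
          exact ENNReal.toReal_mono (measure_ne_top _ _) (measure_mono_ae hincl)
      _ ≤ q ^ (j + 1) := hlad j m hm
  have hcast : ((k₀ * (k₀ + 1) ^ j : ℕ) : ℝ) = (k₀ : ℝ) * ((k₀ : ℝ) + 1) ^ j := by push_cast; ring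
  have halg : 726 * ((k₀ : ℝ) * ((k₀ : ℝ) + 1) ^ j) ^ 2 * q ^ (j + 1) = A * t ^ j := by
    rw [hA, ht]
    generalize ((k₀ : ℝ) + 1) = K
    ring
  calc 726 * ((k₀ * (k₀ + 1) ^ j : ℕ) : ℝ) ^ 2 * μ.real _
      ≤ 726 * ((k₀ * (k₀ + 1) ^ j : ℕ) : ℝ) ^ 2 * q ^ (j + 1) := by gcongr
    _ = 726 * ((k₀ : ℝ) * ((k₀ : ℝ) + 1) ^ j) ^ 2 * q ^ (j + 1) := by rw [hcast]
    _ = A * t ^ j := halg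
    _ ≤ 1 / 2 := hjA

end Summit.CriticalPhenomena.PercolationContinuityZ3.Theorems.NonProliferation

end
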